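import Literature.AlgebraicGeometry.AbelianSchemes.HomEqualityLocusClosed
import Literature.AlgebraicGeometry.AbelianSchemes.SerreTwistBaseChange
import Literature.AlgebraicGeometry.AbelianSchemes.TupleIsoAtOfFibreIsoPoints
import Literature.AlgebraicGeometry.AbelianSchemes.AbelianSchemeFibreFrobeniusTwist
import HarnessLib

/-!
# A polarisation law in dual-homomorphism form `U ≫ λ_B ≫ U^∨ = λ_A ≫ [c]` is DECIDED AT ONE FIELD POINT, TRANSPORTS along
# `λ`-exact isomorphisms, and the base-change comparison isomorphisms ARE `λ`-exact in that form («(G-λ)» of the R6 reading glue)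

Topic `AlgebraicGeometry/AbelianSchemes`; namespace `Literature.AlgebraicGeometry.AbelianSchemes.AbelianSchemeOver`.  THEOREMS ONLY (no def,
no instance, no notation, no named fact, no `sorry`).  Cell hodgecm-mathlib (D-0151), P6 «MOD programme», sub-desk P6a, organ **(G-λ)** of the R6 row
«`RoofΩ → Roof₀` reading glue» (A-p03 (g30) census `CENSUS-R6-RoofCoverReadingGlue`, LEAD deal 2026-09-01 21:58Z): the P6a moduli datum՚s downstairs
roof law (r3₀) `q̄ ≫ λ_B̄ ≫ q̄^∨ = λ_x̄ ≫ [p]` (★ `Roof₀`; EXACT, ★ `DualPair.dualIsogenyOver`, ★ `mulN`) must be obtained from the upstairs law (r3) for the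
`Ω`-isogeny `q` through ★ (ν7) `exists_stage_hom_reduction_turnkey`, which delivers a homomorphism `U` over a finite Dedekind STAGE whose `Ω`-fibre is `q`
read through the five-piece along-stage isomorphisms of ★ (ν6) §1 (pieces ★ `fibreBaseChangeIso` = the comparison ★ `baseChangeCompGrpIso`, and ★
`fibreCongrPtIso`).  This file supplies the three generic moves of that transfer.  HC_CM is proved only modulo the printed citations until rung 0
closes; nothing here is about HC.

THE MATHEMATICS.  [MumfordFogartyKirwan1994] Ch. 6 §1 Cor. 6.2 (rigidity: homomorphisms of abelian schemes over a connected base agreeing at one point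
agree), Cor. 6.8 (the dual commutes with base change); [MumfordAV1970] §15 Thm. 1 ∕ [MilneAV2008] I §9 (`(ψ ≫ χ)^∨ = χ^∨ ≫ ψ^∨`, `𝟙^∨ = 𝟙`);
[GortzWedhorn2020] (4.7) (`X ×_S T ≅ (X ×_S S′) ×_{S′} T`).
* §1 **`comp_lam_comp_dualIsogenyOver_eq_mulN_of_baseChangeHom`** (+ `_iff_`): over a connected reduced locally Noetherian `S`, the law
  `U ≫ λ_B ≫ U^∨ = λ_A ≫ [c]` holds iff it holds after base change to ONE field point `t : Spec K → S` (★ `eq_of_pullback_map_eq_of_preconnectedSpace`,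
  ★ `DualPair.baseChangeHom_dualIsogenyOver_base`, ★ `baseChangeHom_mulN`; converse ★ `baseChangeHom_similitude_base`).
* §2 **`comp_lam_comp_dualIsogenyOver_eq_mulN_iff_of_iso`**: the law for `U : A → B` iff the law for `e_A ≫ U ≫ e_B⁻¹ : A′ → B′` when `e_A, e_B`
  are `λ`-EXACT isomorphisms (`e ≫ λ ≫ e^∨ = λ′`); `comp_mulN_eq_mulN_comp`, `isIso_dualIsogenyOver_hom` (inverse `Ĥ_e`, ★ part 1).
* §3 `λ`-exactness COMPOSES (`comp_comp_lam_comp_dualIsogenyOver_comp`); **the comparison `E : 𝒜 ×_Y T ≅ (𝒜 ×_Y Y₀) ×_{Y₀} T` is `λ`-exact in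
  dual-homomorphism form** in both directions (`baseChangeCompGrpIso_hom∕inv_comp_lam_comp_dualIsogenyOver`), via **`Ê = (E⁻¹)^∨`**
  (`hat_baseChangeCompGrpIso_hom_eq_dualIsogenyOver_inv`: `Ê` satisfies the Poincaré clause for `E` ★ `DualPair.nonempty_pullback_map_hom_P_iso`, hence
  is the dual transport ★ `eq_hatTransport_of_nonempty_pullback_map_iso`, hence `(E⁻¹)^∨` ★ `hatTransportOver_eq_dualIsogenyOver_inv`) and **`E^∨ = Ê⁻¹`**;
  and so is the transport along an equality of points (`fibreCongrPtIso_hom∕inv_comp_lam_comp_dualIsogenyOver`).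
* §4 **`alongStageIso_hom_comp_lam_comp_dualIsogenyOver`**: the literal FIVE-PIECE along-stage isomorphism of ★ (ν6)
  `AbelianSchemeHomReductionAlongStage` §1 (`fibreBaseChangeIso ≪≫ fibreCongrPtIso ≪≫ fibreBaseChangeIso⁻¹ ≪≫ fibreCongrPtIso⁻¹ ≪≫ fibreBaseChangeIso⁻¹`)
  is `λ`-exact in dual-homomorphism form — the hypotheses `hA`∕`hB` of §2 for the turnkey՚s `Ω`-fibre identity and its special twin.

## References
* [MumfordFogartyKirwan1994] D. Mumford, J. Fogarty, F. Kirwan, *Geometric Invariant Theory*, 3rd ed. (1994), Ch. 6 §1 Cor. 6.2 (p. 116), Cor. 6.5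
  (p. 117), Cor. 6.8 (p. 118); Ch. 7 §2 Def. 7.2 (p. 129).
* [MumfordAV1970] D. Mumford, *Abelian Varieties* (1970), §15 Thm. 1 (p. 143).
* [MilneAV2008] J. S. Milne, *Abelian Varieties* (2008), I §8 pp. 36–37, I §9 Thm. 9.1 (p. 42).
* [GortzWedhorn2020] U. Görtz, T. Wedhorn, *Algebraic Geometry I*, 2nd ed. (2020), Section (4.7) (pp. 107–108).
-/

set_option autoImplicit false
set_option backward.isDefEq.respectTransparency false

noncomputable section

universe u

open CategoryTheory CategoryTheory.Limits AlgebraicGeometry MonoidalCategory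
open scoped MonObj

namespace Literature.AlgebraicGeometry.AbelianSchemes

namespace AbelianSchemeOver

/-! ### §1 The law is decided at one field point (rigidity, [MumfordFogartyKirwan1994] Ch. 6 §1 Cor. 6.2) -/

section AtFieldPoint

variable {S : Scheme.{u}} [IsLocallyNoetherian S] [PreconnectedSpace S] [IsReduced S] {A B : AbelianSchemeOver S}
  (DA : A.DualPair) (DB : B.DualPair)
  (hDA : Nonempty ((Scheme.Modules.pullback (DualPair.unitHatSlice DA)).obj DA.P ≅ SheafOfModules.unit _))
  (hDB : Nonempty ((Scheme.Modules.pullback (DualPair.unitHatSlice DB)).obj DB.P ≅ SheafOfModules.unit _))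
  (U : A.X ⟶ B.X) [IsMonHom U] (lamA : A.X ⟶ DA.hat.X) (lamB : B.X ⟶ DB.hat.X) [IsMonHom lamA] [IsMonHom lamB] (c : ℕ)
  {K : Type u} [Field K] (t : Spec (.of K) ⟶ S)

include hDA hDB in
/-- **A POLARISATION LAW IN DUAL-HOMOMORPHISM FORM IS DECIDED AT ONE FIELD POINT.**  Over a connected, reduced, locally Noetherian
base `S` (e.g. the spectrum of a Dedekind domain), for homomorphisms `U : A → B`, `λ_A : A → Â`, `λ_B : B → B̂` of abelian schemes
(dual pairs normalised along `A × {ε}`, `B × {ε}`) and `c ∈ ℕ`: if the base changes to ONE field-valued point `t : Spec K → S` satisfy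
`U_t ≫ (λ_B)_t ≫ (U_t)^∨ = (λ_A)_t ≫ [c]` (duals formed with the base-changed pairs, ★ `DualPair.baseChange`), then
`U ≫ λ_B ≫ U^∨ = λ_A ≫ [c]` over `S` — both sides are homomorphisms `A → Â` (★ `isMonHom_dualIsogenyOver`, ★ `isMonHom_mulN`) whose
base changes to `t` agree (`(U^∨)_t = (U_t)^∨` ★ `baseChangeHom_dualIsogenyOver_base`, `[c]_t = [c]` ★ `baseChangeHom_mulN`), so rigidity
([MumfordFogartyKirwan1994] Cor. 6.2, ★ `eq_of_pullback_map_eq_of_preconnectedSpace`) applies.  The converse is ★ `baseChangeHom_similitude_base`.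
[cite: MumfordFogartyKirwan1994, Ch. 6 §1 Corollary 6.2 (p. 116) and Corollary 6.8 (p. 118)] [cite: MumfordAV1970, §15 Thm. 1 (p. 143)] -/
theorem comp_lam_comp_dualIsogenyOver_eq_mulN_of_baseChangeHom
    (h : baseChangeHom U t ≫ baseChangeHom lamB t ≫
        @DualPair.dualIsogenyOver _ (A.baseChange t) (B.baseChange t) (baseChangeHom U t) (isMonHom_baseChangeHom U t)
          (DA.baseChange t) (DB.baseChange t) =
      baseChangeHom lamA t ≫ (DA.baseChange t).hat.mulN c) :
    U ≫ lamB ≫ DualPair.dualIsogenyOver U DA DB = lamA ≫ DA.hat.mulN c := by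
  haveI := DualPair.isMonHom_dualIsogenyOver U DA DB hDB hDA
  haveI : IsCommMonObj DA.hat.X := DA.hat.isCommMonObj_of_isReduced_base
  haveI := DA.hat.isMonHom_mulN c
  refine eq_of_pullback_map_eq_of_preconnectedSpace (U ≫ lamB ≫ DualPair.dualIsogenyOver U DA DB) (lamA ≫ DA.hat.mulN c) t ?_
  rw [Functor.map_comp, Functor.map_comp, Functor.map_comp]
  change baseChangeHom U t ≫ baseChangeHom lamB t ≫ baseChangeHom (A := DB.hat) (B := DA.hat) (DualPair.dualIsogenyOver U DA DB) t =
    baseChangeHom lamA t ≫ (Over.pullback t).map (DA.hat.mulN c)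
  rw [DualPair.baseChangeHom_dualIsogenyOver_base t U DA DB,
    show (Over.pullback t).map (DA.hat.mulN c) = (DA.baseChange t).hat.mulN c from DA.hat.baseChangeHom_mulN t c]
  exact h

include hDA hDB in
/-- **… IFF** (with the forward direction ★ `baseChangeHom_similitude_base`). [cite: MumfordFogartyKirwan1994, Ch. 6 §1 Corollary 6.2 (p. 116) and Corollary 6.8 (p. 118)] -/
theorem comp_lam_comp_dualIsogenyOver_eq_mulN_iff_baseChangeHom :
    U ≫ lamB ≫ DualPair.dualIsogenyOver U DA DB = lamA ≫ DA.hat.mulN c ↔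
      baseChangeHom U t ≫ baseChangeHom lamB t ≫
          @DualPair.dualIsogenyOver _ (A.baseChange t) (B.baseChange t) (baseChangeHom U t) (isMonHom_baseChangeHom U t)
            (DA.baseChange t) (DB.baseChange t) =
        baseChangeHom lamA t ≫ (DA.baseChange t).hat.mulN c :=
  ⟨DualPair.baseChangeHom_similitude_base t U DA DB lamA lamB c,
    comp_lam_comp_dualIsogenyOver_eq_mulN_of_baseChangeHom DA DB hDA hDB U lamA lamB c t⟩

end AtFieldPoint

/-! ### §2 The law transports along `λ`-exact isomorphisms ([MumfordAV1970] §15 Thm. 1: `(ψ ≫ χ)^∨ = χ^∨ ≫ ψ^∨`, `𝟙^∨ = 𝟙`) -/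

section Transport

variable {S : Scheme.{u}} [IsReduced S] [IsLocallyNoetherian S] {A A' B B' : AbelianSchemeOver S}
  (DA : A.DualPair) (DA' : A'.DualPair) (DB : B.DualPair) (DB' : B'.DualPair)
  (hDA : Nonempty ((Scheme.Modules.pullback (DualPair.unitHatSlice DA)).obj DA.P ≅ SheafOfModules.unit _))
  (hDA' : Nonempty ((Scheme.Modules.pullback (DualPair.unitHatSlice DA')).obj DA'.P ≅ SheafOfModules.unit _))
  (hDB : Nonempty ((Scheme.Modules.pullback (DualPair.unitHatSlice DB)).obj DB.P ≅ SheafOfModules.unit _))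
  (lamA : A.X ⟶ DA.hat.X) (lamA' : A'.X ⟶ DA'.hat.X) (lamB : B.X ⟶ DB.hat.X) (lamB' : B'.X ⟶ DB'.hat.X)
  (eA : A'.X ≅ A.X) (eB : B'.X ≅ B.X) [IsMonHom eA.hom] [IsMonHom eB.hom] (U : A.X ⟶ B.X) [IsMonHom U] (c : ℕ)

omit [IsReduced S] [IsLocallyNoetherian S] in
/-- A homomorphism commutes with `[c]`: `f ≫ [c] = [c] ≫ f` (`(𝟙 ≫ f)^c = (f ≫ 𝟙)^c`). [cite: MumfordFogartyKirwan1994, Ch. 6 §1 Corollary 6.5 (p. 117)] -/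
theorem comp_mulN_eq_mulN_comp {X Y : AbelianSchemeOver S} (f : X.X ⟶ Y.X) [IsMonHom f] (c : ℕ) :
    f ≫ Y.mulN c = X.mulN c ≫ f := by
  rw [mulN_def, mulN_def, MonObj.comp_pow, Category.comp_id, MonObj.pow_comp, Category.id_comp]

include hDA in
/-- `e^∨` is an isomorphism for an isomorphism `e` (inverse `Ĥ_e`, ★ part 1 `dualIsogenyOver_hom_comp_hatTransportOver` ∕
`hatTransportOver_comp_dualIsogenyOver_hom`). [cite: MilneAV2008, I §8 pp. 36–37] -/
theorem isIso_dualIsogenyOver_hom : IsIso (DualPair.dualIsogenyOver eA.hom DA' DA) :=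
  ⟨DualPair.hatTransportOver DA DA' eA, DualPair.dualIsogenyOver_hom_comp_hatTransportOver DA DA' eA hDA,
    DualPair.hatTransportOver_comp_dualIsogenyOver_hom DA DA' eA hDA⟩

include hDA hDA' hDB in
/-- **THE LAW TRANSPORTS ALONG `λ`-EXACT ISOMORPHISMS.**  If `e_A : A′ ≅ A` and `e_B : B′ ≅ B` are isomorphisms of `S`-group schemes
exact on the polarisations in dual-homomorphism form (`e_A ≫ λ_A ≫ e_A^∨ = λ_{A′}`, `e_B ≫ λ_B ≫ e_B^∨ = λ_{B′}`), then for a homomorphism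
`U : A → B` and `c ∈ ℕ`: `U ≫ λ_B ≫ U^∨ = λ_A ≫ [c]` iff the conjugate `U′ := e_A ≫ U ≫ e_B⁻¹ : A′ → B′` satisfies
`U′ ≫ λ_{B′} ≫ U′^∨ = λ_{A′} ≫ [c]` — by `(ψ ≫ χ)^∨ = χ^∨ ≫ ψ^∨` (★ `dualIsogenyOver_comp`), `e_B⁻¹ ≫ λ_{B′} ≫ (e_B⁻¹)^∨ = λ_B`
(★ `inv_comp_lam_comp_dualIsogenyOver_inv_of_eq`), `[c]` commuting with homomorphisms, and cancelling `e_A`, `e_A^∨`.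
[cite: MumfordAV1970, §15 Thm. 1 (p. 143)] [cite: MilneAV2008, I §9 Thm. 9.1 (p. 42)] [cite: MumfordFogartyKirwan1994, Ch. 7 §2 Definition 7.2 (p. 129)] -/
theorem comp_lam_comp_dualIsogenyOver_eq_mulN_iff_of_iso
    (hA : eA.hom ≫ lamA ≫ DualPair.dualIsogenyOver eA.hom DA' DA = lamA')
    (hB : eB.hom ≫ lamB ≫ DualPair.dualIsogenyOver eB.hom DB' DB = lamB') :
    U ≫ lamB ≫ DualPair.dualIsogenyOver U DA DB = lamA ≫ DA.hat.mulN c ↔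
      (eA.hom ≫ U ≫ eB.inv) ≫ lamB' ≫ DualPair.dualIsogenyOver (eA.hom ≫ U ≫ eB.inv) DA' DB' = lamA' ≫ DA'.hat.mulN c := by
  haveI := isIso_dualIsogenyOver_hom DA DA' hDA eA
  haveI := DualPair.isMonHom_dualIsogenyOver eA.hom DA' DA hDA hDA'
  -- the conjugated law, unfolded: `e_A ≫ (U ≫ λ_B ≫ U^∨) ≫ e_A^∨ = e_A ≫ (λ_A ≫ [c]) ≫ e_A^∨`
  have hB' : eB.inv ≫ lamB' ≫ DualPair.dualIsogenyOver eB.inv DB DB' = lamB :=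
    inv_comp_lam_comp_dualIsogenyOver_inv_of_eq DB' DB lamB' lamB hDB eB hB
  have key : (eA.hom ≫ U ≫ eB.inv) ≫ lamB' ≫ DualPair.dualIsogenyOver (eA.hom ≫ U ≫ eB.inv) DA' DB' =
      eA.hom ≫ (U ≫ lamB ≫ DualPair.dualIsogenyOver U DA DB) ≫ DualPair.dualIsogenyOver eA.hom DA' DA := by
    rw [DualPair.dualIsogenyOver_comp eA.hom (U ≫ eB.inv) DA' DA DB', DualPair.dualIsogenyOver_comp U eB.inv DA DB DB',
      ← hB']
    simp only [Category.assoc]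
  have key' : lamA' ≫ DA'.hat.mulN c = eA.hom ≫ (lamA ≫ DA.hat.mulN c) ≫ DualPair.dualIsogenyOver eA.hom DA' DA := by
    rw [← hA, Category.assoc, Category.assoc, Category.assoc, comp_mulN_eq_mulN_comp (DualPair.dualIsogenyOver eA.hom DA' DA) c]
  rw [key, key', cancel_epi, cancel_mono]

end Transport

/-! ### §3 The base-change comparison isomorphisms are `λ`-exact in dual-homomorphism form -/

section Composition

variable {S : Scheme.{u}} {A₁ A₂ A₃ : AbelianSchemeOver S} (D₁ : A₁.DualPair) (D₂ : A₂.DualPair) (D₃ : A₃.DualPair)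
  (lam₁ : A₁.X ⟶ D₁.hat.X) (lam₂ : A₂.X ⟶ D₂.hat.X) (lam₃ : A₃.X ⟶ D₃.hat.X)
  (f : A₁.X ⟶ A₂.X) (g : A₂.X ⟶ A₃.X) [IsMonHom f] [IsMonHom g]

/-- **`λ`-exactness in dual-homomorphism form COMPOSES**: `f ≫ λ₂ ≫ f^∨ = λ₁` and `g ≫ λ₃ ≫ g^∨ = λ₂` give
`(f ≫ g) ≫ λ₃ ≫ (f ≫ g)^∨ = λ₁` (★ `dualIsogenyOver_comp`). [cite: MumfordAV1970, §15 Thm. 1 (p. 143)] -/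
theorem comp_comp_lam_comp_dualIsogenyOver_comp (hf : f ≫ lam₂ ≫ DualPair.dualIsogenyOver f D₁ D₂ = lam₁)
    (hg : g ≫ lam₃ ≫ DualPair.dualIsogenyOver g D₂ D₃ = lam₂) :
    (f ≫ g) ≫ lam₃ ≫ DualPair.dualIsogenyOver (f ≫ g) D₁ D₃ = lam₁ := by
  rw [DualPair.dualIsogenyOver_comp f g D₁ D₂ D₃, ← hf, ← hg]
  simp only [Category.assoc]

end Composition

section Comparison

variable {Y Y₀ T : Scheme.{u}} [IsReduced T] [IsLocallyNoetherian T] (𝒜 : AbelianSchemeOver Y) (D : 𝒜.DualPair)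
  (pol : 𝒜.Polarization D) (π : Y₀ ⟶ Y) (x : T ⟶ Y₀)

omit [IsReduced T] [IsLocallyNoetherian T] in
/-- **The hat comparison `Ê : Â ×_Y T ≅ (Â ×_Y Y₀) ×_{Y₀} T` IS the dual homomorphism of `E⁻¹`** (`E` the comparison for `𝒜`):
`Ê` satisfies the Poincaré clause for `E` (★ `DualPair.nonempty_pullback_map_hom_P_iso`), so it is the dual transport `Ĥ_E` (★
`eq_hatTransport_of_nonempty_pullback_map_iso'`), which is `(E⁻¹)^∨` (★ part 1 `hatTransportOver_eq_dualIsogenyOver_inv`).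
[cite: MilneAV2008, I §8 pp. 36–37] [cite: GortzWedhorn2020, Section (4.7) (pp. 107–108)] -/
theorem hat_baseChangeCompGrpIso_hom_eq_dualIsogenyOver_inv :
    (D.hat.baseChangeCompGrpIso π x).hom.hom.hom =
      DualPair.dualIsogenyOver (𝒜.baseChangeCompGrpIso π x).inv.hom.hom ((D.baseChange π).baseChange x) (D.baseChange (x ≫ π)) := by
  -- the comparison as an isomorphism of `Over T`
  let e : (𝒜.baseChange (x ≫ π)).X ≅ ((𝒜.baseChange π).baseChange x).X :=
    ⟨(𝒜.baseChangeCompGrpIso π x).hom.hom.hom, (𝒜.baseChangeCompGrpIso π x).inv.hom.hom,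
      𝒜.baseChangeCompGrpIso_hom_hom_hom_comp_inv π x, 𝒜.baseChangeCompGrpIso_inv_hom_hom_comp_hom π x⟩
  haveI : IsMonHom e.hom := (inferInstance : IsMonHom (𝒜.baseChangeCompGrpIso π x).hom.hom.hom)
  have wH : (𝒜.baseChange (x ≫ π)).X.hom ≫ 𝟙 T =
      (𝒜.baseChangeCompGrpIso π x).hom.hom.hom.left ≫ ((𝒜.baseChange π).baseChange x).X.hom := by
    rw [Category.comp_id, Over.w]
  have wĤ : (D.baseChange (x ≫ π)).hat.X.hom ≫ 𝟙 T =
      (D.hat.baseChangeCompGrpIso π x).hom.hom.hom.left ≫ ((D.baseChange π).baseChange x).hat.X.hom := by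
    rw [Category.comp_id]
    exact (Over.w (D.hat.baseChangeCompGrpIso π x).hom.hom.hom).symm
  have hĤ : (D.hat.baseChangeCompGrpIso π x).hom.hom.hom.left =
      DualPair.hatTransport ((D.baseChange π).baseChange x) (D.baseChange (x ≫ π)) e :=
    DualPair.eq_hatTransport_of_nonempty_pullback_map_iso ((D.baseChange π).baseChange x) (D.baseChange (x ≫ π)) e _ wH wĤ
      (DualPair.nonempty_pullback_map_hom_P_iso 𝒜 D π x wH wĤ)
  apply Over.OverMorphism.ext
  rw [hĤ, ← DualPair.hatTransportOver_left, DualPair.hatTransportOver_eq_dualIsogenyOver_inv]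

/-- **`E^∨ = Ê⁻¹`**: the dual homomorphism of the comparison `E : 𝒜 ×_Y T ≅ (𝒜 ×_Y Y₀) ×_{Y₀} T` is the inverse hat comparison
(`E^∨ ≫ (E⁻¹)^∨ = (E⁻¹ ≫ E)^∨ = 𝟙^∨ = 𝟙`, ★ `dualIsogenyOver_comp` ∕ `dualIsogenyOver_id'`; `hD`: the iterated dual pair is normalised,
e.g. ★ `Polarization.nonempty_unitHatSlice_iso`). [cite: MumfordAV1970, §15 Thm. 1 (p. 143)] [cite: GortzWedhorn2020, Section (4.7) (pp. 107–108)] -/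
theorem dualIsogenyOver_baseChangeCompGrpIso_hom_eq_hat_inv
    (hD : Nonempty ((Scheme.Modules.pullback (DualPair.unitHatSlice ((D.baseChange π).baseChange x))).obj
      ((D.baseChange π).baseChange x).P ≅ SheafOfModules.unit _)) :
    DualPair.dualIsogenyOver (𝒜.baseChangeCompGrpIso π x).hom.hom.hom (D.baseChange (x ≫ π)) ((D.baseChange π).baseChange x) =
      (D.hat.baseChangeCompGrpIso π x).inv.hom.hom := by
  have H1 := hat_baseChangeCompGrpIso_hom_eq_dualIsogenyOver_inv 𝒜 D π x
  have H2 := DualPair.dualIsogenyOver_comp (𝒜.baseChangeCompGrpIso π x).inv.hom.hom (𝒜.baseChangeCompGrpIso π x).hom.hom.hom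
    ((D.baseChange π).baseChange x) (D.baseChange (x ≫ π)) ((D.baseChange π).baseChange x)
  have H3 := DualPair.dualIsogenyOver_congr ((D.baseChange π).baseChange x) ((D.baseChange π).baseChange x) (ψ₂ := 𝟙 _)
    (h₁ := inferInstance) (h₂ := inferInstance) (𝒜.baseChangeCompGrpIso_inv_hom_hom_comp_hom π x)
  have H4 := DualPair.dualIsogenyOver_id' ((D.baseChange π).baseChange x) hD
  -- `E^∨ ≫ Ê = 𝟙`
  have hcomp : DualPair.dualIsogenyOver (𝒜.baseChangeCompGrpIso π x).hom.hom.hom (D.baseChange (x ≫ π)) ((D.baseChange π).baseChange x) ≫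
      (D.hat.baseChangeCompGrpIso π x).hom.hom.hom = 𝟙 _ :=
    (congrArg (DualPair.dualIsogenyOver (𝒜.baseChangeCompGrpIso π x).hom.hom.hom (D.baseChange (x ≫ π))
      ((D.baseChange π).baseChange x) ≫ ·) H1).trans (H2.symm.trans (H3.trans H4))
  have h5 : (D.hat.baseChangeCompGrpIso π x).hom.hom.hom ≫ (D.hat.baseChangeCompGrpIso π x).inv.hom.hom =
      𝟙 ((D.baseChange (x ≫ π)).hat.X) := D.hat.baseChangeCompGrpIso_hom_hom_hom_comp_inv π x
  have h6 := congrArg (DualPair.dualIsogenyOver (𝒜.baseChangeCompGrpIso π x).hom.hom.hom (D.baseChange (x ≫ π))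
      ((D.baseChange π).baseChange x) ≫ ·) h5
  simp only [← Category.assoc, hcomp, Category.id_comp, Category.comp_id] at h6
  exact h6.symm

/-- **THE COMPARISON `E : 𝒜 ×_Y T ≅ (𝒜 ×_Y Y₀) ×_{Y₀} T` IS `λ`-EXACT IN DUAL-HOMOMORPHISM FORM**:
`E ≫ ((λ ×_Y Y₀) ×_{Y₀} T) ≫ E^∨ = λ ×_Y T` (naturality of the comparison at `λ`, ★ `baseChangeCompGrpIso_hom_naturality`, and
`E^∨ = Ê⁻¹`) — the form ★ (ν6) §1's along-stage isomorphisms (pieces ★ `fibreBaseChangeIso`) must have for the transport of §2.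
[cite: MumfordFogartyKirwan1994, Ch. 7 §2 Definition 7.2 (p. 129)] [cite: GortzWedhorn2020, Section (4.7) (pp. 107–108)] -/
theorem baseChangeCompGrpIso_hom_comp_lam_comp_dualIsogenyOver :
    (𝒜.baseChangeCompGrpIso π x).hom.hom.hom ≫ ((pol.baseChange π).baseChange x).lam ≫
        DualPair.dualIsogenyOver (𝒜.baseChangeCompGrpIso π x).hom.hom.hom (D.baseChange (x ≫ π)) ((D.baseChange π).baseChange x) =
      (pol.baseChange (x ≫ π)).lam := by
  haveI := pol.isMonHom
  rw [dualIsogenyOver_baseChangeCompGrpIso_hom_eq_hat_inv 𝒜 D π x ((pol.baseChange π).baseChange x).nonempty_unitHatSlice_iso]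
  have hnat : (pol.baseChange (x ≫ π)).lam ≫ (D.hat.baseChangeCompGrpIso π x).hom.hom.hom =
      (𝒜.baseChangeCompGrpIso π x).hom.hom.hom ≫ ((pol.baseChange π).baseChange x).lam :=
    baseChangeCompGrpIso_hom_naturality 𝒜 π x pol.lam
  have h5 : (D.hat.baseChangeCompGrpIso π x).hom.hom.hom ≫ (D.hat.baseChangeCompGrpIso π x).inv.hom.hom =
      𝟙 ((D.baseChange (x ≫ π)).hat.X) := D.hat.baseChangeCompGrpIso_hom_hom_hom_comp_inv π x
  have h6 := congrArg (· ≫ (D.hat.baseChangeCompGrpIso π x).inv.hom.hom) hnat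
  simp only [Category.assoc, h5, Category.comp_id] at h6
  exact h6.symm

/-- **The inverse comparison `E⁻¹` is `λ`-exact in dual-homomorphism form**: `E⁻¹ ≫ (λ ×_Y T) ≫ (E⁻¹)^∨ = (λ ×_Y Y₀) ×_{Y₀} T` (★
`inv_comp_lam_comp_dualIsogenyOver_inv_of_eq`); this is the Over-level morphism of ★ `fibreBaseChangeIso` (`fibreBaseChangeIso_hom_toSchemeHom`).
[cite: MumfordFogartyKirwan1994, Ch. 7 §2 Definition 7.2 (p. 129)] [cite: GortzWedhorn2020, Section (4.7) (pp. 107–108)] -/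
theorem baseChangeCompGrpIso_inv_comp_lam_comp_dualIsogenyOver :
    (𝒜.baseChangeCompGrpIso π x).inv.hom.hom ≫ (pol.baseChange (x ≫ π)).lam ≫
        DualPair.dualIsogenyOver (𝒜.baseChangeCompGrpIso π x).inv.hom.hom ((D.baseChange π).baseChange x) (D.baseChange (x ≫ π)) =
      ((pol.baseChange π).baseChange x).lam := by
  let e : (𝒜.baseChange (x ≫ π)).X ≅ ((𝒜.baseChange π).baseChange x).X :=
    ⟨(𝒜.baseChangeCompGrpIso π x).hom.hom.hom, (𝒜.baseChangeCompGrpIso π x).inv.hom.hom,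
      𝒜.baseChangeCompGrpIso_hom_hom_hom_comp_inv π x, 𝒜.baseChangeCompGrpIso_inv_hom_hom_comp_hom π x⟩
  haveI : IsMonHom e.hom := (inferInstance : IsMonHom (𝒜.baseChangeCompGrpIso π x).hom.hom.hom)
  exact inv_comp_lam_comp_dualIsogenyOver_inv_of_eq (D.baseChange (x ≫ π)) ((D.baseChange π).baseChange x)
    (pol.baseChange (x ≫ π)).lam ((pol.baseChange π).baseChange x).lam ((pol.baseChange π).baseChange x).nonempty_unitHatSlice_iso e
    (baseChangeCompGrpIso_hom_comp_lam_comp_dualIsogenyOver 𝒜 D pol π x)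

end Comparison

section CongrPt

variable {S : Scheme.{u}} {K : Type u} [Field K] (A : AbelianSchemeOver S) (D : A.DualPair) (pol : A.Polarization D)
  {s₁ s₂ : Spec (.of K) ⟶ S}

/-- **Transport along an equality of points is `λ`-exact in dual-homomorphism form** (★ `fibreCongrPtIso h`, an `eqToIso`; after
`subst` it is the identity and `𝟙^∨ = 𝟙`, ★ `dualIsogenyOver_id'`). [cite: MumfordFogartyKirwan1994, Ch. 7 §2 Definition 7.2 (p. 129)] -/
theorem fibreCongrPtIso_hom_comp_lam_comp_dualIsogenyOver (h : s₁ = s₂) :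
    (A.fibreCongrPtIso h).hom.hom.hom.hom ≫ (pol.baseChange s₂).lam ≫
        @DualPair.dualIsogenyOver _ (A.baseChange s₁) (A.baseChange s₂) (A.fibreCongrPtIso h).hom.hom.hom.hom
          (A.fibreCongrPtIso h).hom.hom.hom.isMonHom_hom (D.baseChange s₁) (D.baseChange s₂) =
      (pol.baseChange s₁).lam := by
  subst h
  have h1 : (A.fibreCongrPtIso (rfl : s₁ = s₁)).hom.hom.hom.hom = 𝟙 (A.baseChange s₁).X := rfl
  rw [DualPair.dualIsogenyOver_congr (D.baseChange s₁) (D.baseChange s₁) (ψ₂ := 𝟙 _) (h₂ := inferInstance) h1, h1,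
    DualPair.dualIsogenyOver_id' _ (pol.baseChange s₁).nonempty_unitHatSlice_iso]
  exact (Category.id_comp _).trans (Category.comp_id _)

end CongrPt

section CongrPtInv

variable {S : Scheme.{u}} {K : Type u} [Field K] (A : AbelianSchemeOver S) (D : A.DualPair) (pol : A.Polarization D)
  {s₁ s₂ : Spec (.of K) ⟶ S}

/-- The inverse transport along an equality of points is `λ`-exact in dual-homomorphism form. [cite: MumfordFogartyKirwan1994, Ch. 7 §2 Definition 7.2 (p. 129)] -/
theorem fibreCongrPtIso_inv_comp_lam_comp_dualIsogenyOver (h : s₁ = s₂) :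
    (A.fibreCongrPtIso h).inv.hom.hom.hom ≫ (pol.baseChange s₁).lam ≫
        @DualPair.dualIsogenyOver _ (A.baseChange s₂) (A.baseChange s₁) (A.fibreCongrPtIso h).inv.hom.hom.hom
          (A.fibreCongrPtIso h).inv.hom.hom.isMonHom_hom (D.baseChange s₂) (D.baseChange s₁) =
      (pol.baseChange s₂).lam := by
  subst h
  have h1 : (A.fibreCongrPtIso (rfl : s₁ = s₁)).inv.hom.hom.hom = 𝟙 (A.baseChange s₁).X := rfl
  rw [DualPair.dualIsogenyOver_congr (D.baseChange s₁) (D.baseChange s₁) (ψ₂ := 𝟙 _) (h₂ := inferInstance) h1, h1,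
    DualPair.dualIsogenyOver_id' _ (pol.baseChange s₁).nonempty_unitHatSlice_iso]
  exact (Category.id_comp _).trans (Category.comp_id _)

end CongrPtInv

/-! ### §4 The FIVE-PIECE along-stage isomorphism of ★ (ν6) §1 is `λ`-exact in dual-homomorphism form -/

section AlongStage

variable {T U V V' : Scheme.{u}} {Ω : Type u} [Field Ω]
  (j : U ⟶ T) (z : V ⟶ T) (g : V' ⟶ V) (y : Spec (.of Ω) ⟶ U) (a : Spec (.of Ω) ⟶ V) (a' : Spec (.of Ω) ⟶ V')
  (hpt : y ≫ j = a ≫ z) (e : a' ≫ g = a) (𝒜 : AbelianSchemeOver T) (D : 𝒜.DualPair) (pol : 𝒜.Polarization D)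

/-- **THE FIVE-PIECE ALONG-STAGE ISOMORPHISM IS `λ`-EXACT IN DUAL-HOMOMORPHISM FORM**: for the literal composite
`E := fibreBaseChangeIso j y ≪≫ fibreCongrPtIso hpt ≪≫ (fibreBaseChangeIso z a)⁻¹ ≪≫ (fibreCongrPtIso e)⁻¹ ≪≫ (fibreBaseChangeIso g a′)⁻¹` of ★
(ν6) `AbelianSchemeHomReductionAlongStage` §1 (from the fibre of `𝒜 ×_T U` at `y` to the fibre of `(𝒜 ×_T V) ×_V V′` at `a′`),
`E ≫ λ_{((𝒜_V)_{V′})_{a′}} ≫ E^∨ = λ_{(𝒜_U)_y}` — each piece is `λ`-exact (§3) and `λ`-exactness composes.  This is the hypothesis `hA`∕`hB` of §2 for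
the turnkey ★ (ν7)'s `Ω`-fibre identity `U_ξ = E_𝒜⁻¹ ≫ u ≫ E_𝒞` and for its special-fibre twin. [cite: MumfordFogartyKirwan1994, Ch. 7 §2 Definition 7.2 (p. 129)]
[cite: GortzWedhorn2020, Section (4.7) (pp. 107–108) and Prop. 4.16 (p. 101)] -/
theorem alongStageIso_hom_comp_lam_comp_dualIsogenyOver :
    (𝒜.fibreBaseChangeIso j y ≪≫ 𝒜.fibreCongrPtIso hpt ≪≫ (𝒜.fibreBaseChangeIso z a).symm ≪≫
          ((𝒜.baseChange z).fibreCongrPtIso e).symm ≪≫ ((𝒜.baseChange z).fibreBaseChangeIso g a').symm).hom.hom.hom.hom ≫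
        (((pol.baseChange z).baseChange g).baseChange a').lam ≫
        @DualPair.dualIsogenyOver _ ((𝒜.baseChange j).baseChange y) (((𝒜.baseChange z).baseChange g).baseChange a')
          (𝒜.fibreBaseChangeIso j y ≪≫ 𝒜.fibreCongrPtIso hpt ≪≫ (𝒜.fibreBaseChangeIso z a).symm ≪≫
            ((𝒜.baseChange z).fibreCongrPtIso e).symm ≪≫ ((𝒜.baseChange z).fibreBaseChangeIso g a').symm).hom.hom.hom.hom
          (𝒜.fibreBaseChangeIso j y ≪≫ 𝒜.fibreCongrPtIso hpt ≪≫ (𝒜.fibreBaseChangeIso z a).symm ≪≫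
            ((𝒜.baseChange z).fibreCongrPtIso e).symm ≪≫ ((𝒜.baseChange z).fibreBaseChangeIso g a').symm).hom.hom.hom.isMonHom_hom
          ((D.baseChange j).baseChange y) (((D.baseChange z).baseChange g).baseChange a') =
      ((pol.baseChange j).baseChange y).lam := by
  -- the five Over-level pieces
  have h1 := baseChangeCompGrpIso_inv_comp_lam_comp_dualIsogenyOver 𝒜 D pol j y
  have h2 := fibreCongrPtIso_hom_comp_lam_comp_dualIsogenyOver 𝒜 D pol hpt
  have h3 := baseChangeCompGrpIso_hom_comp_lam_comp_dualIsogenyOver 𝒜 D pol z a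
  have h4 := fibreCongrPtIso_inv_comp_lam_comp_dualIsogenyOver (𝒜.baseChange z) (D.baseChange z) (pol.baseChange z) e
  have h5 := baseChangeCompGrpIso_hom_comp_lam_comp_dualIsogenyOver (𝒜.baseChange z) (D.baseChange z) (pol.baseChange z) g a'
  have h12 := comp_comp_lam_comp_dualIsogenyOver_comp _ _ _ _ _ _ _ _ h1 h2
  have h123 := comp_comp_lam_comp_dualIsogenyOver_comp _ _ _ _ _ _ _ _ h12 h3
  have h1234 := comp_comp_lam_comp_dualIsogenyOver_comp _ _ _ _ _ _ _ _ h123 h4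
  have h12345 := comp_comp_lam_comp_dualIsogenyOver_comp _ _ _ _ _ _ _ _ h1234 h5
  -- reassociate the composite of the five Over-level pieces
  have hassoc : ((((𝒜.baseChangeCompGrpIso j y).inv.hom.hom ≫ (𝒜.fibreCongrPtIso hpt).hom.hom.hom.hom) ≫
          (𝒜.baseChangeCompGrpIso z a).hom.hom.hom) ≫ ((𝒜.baseChange z).fibreCongrPtIso e).inv.hom.hom.hom) ≫
        ((𝒜.baseChange z).baseChangeCompGrpIso g a').hom.hom.hom =
      (𝒜.baseChangeCompGrpIso j y).inv.hom.hom ≫ (𝒜.fibreCongrPtIso hpt).hom.hom.hom.hom ≫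
        (𝒜.baseChangeCompGrpIso z a).hom.hom.hom ≫ ((𝒜.baseChange z).fibreCongrPtIso e).inv.hom.hom.hom ≫
          ((𝒜.baseChange z).baseChangeCompGrpIso g a').hom.hom.hom := by
    simp only [Category.assoc]
  rw [DualPair.dualIsogenyOver_congr _ _ (h₂ := inferInstance) hassoc, hassoc] at h12345
  -- the literal five-piece isomorphism, read on `Over (Spec Ω)`, IS that composite
  have hE : (𝒜.fibreBaseChangeIso j y ≪≫ 𝒜.fibreCongrPtIso hpt ≪≫ (𝒜.fibreBaseChangeIso z a).symm ≪≫
          ((𝒜.baseChange z).fibreCongrPtIso e).symm ≪≫ ((𝒜.baseChange z).fibreBaseChangeIso g a').symm).hom.hom.hom.hom =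
      (𝒜.baseChangeCompGrpIso j y).inv.hom.hom ≫ (𝒜.fibreCongrPtIso hpt).hom.hom.hom.hom ≫
        (𝒜.baseChangeCompGrpIso z a).hom.hom.hom ≫ ((𝒜.baseChange z).fibreCongrPtIso e).inv.hom.hom.hom ≫
          ((𝒜.baseChange z).baseChangeCompGrpIso g a').hom.hom.hom := by
    simp only [Iso.trans_hom, Iso.symm_hom]
    rfl
  rw [DualPair.dualIsogenyOver_congr _ _ (h₂ := inferInstance) hE, hE]
  exact h12345

end AlongStage



end AbelianSchemeOver

end Literature.AlgebraicGeometry.AbelianSchemes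

end
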